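import Literature.AnabelianGeometry.SemiGraphs.TreeSystemGeodesicBaseEdges
import HarnessLib

/-!
# Paths of the barycentric subdivision: the TURN of an image walk at a separating vertex, and the local
# structure vertex–branch–edge–branch–vertex ([SemiAnbd] §1 pp. 11–13; used for Thm 3.7 (iii) p. 41)

Mochizuki, *Semi-graphs of anabelioids*, Publ. RIMS **42** (2006), §1 (semi-graphs as topological spaces via the
barycentric subdivision, pp. 11–13) and §3, Thm. 3.7 (iii), proof p. 41 (compatible systems of fixed vertices of the
trees `𝒢_{∞,j}` compared level by level) [cite: MochizukiSemiAnbd2006, Thm 3.7(iii) p.41].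

PROOF-ONLY tool file (cell abc-iut, block F, FACT-LIST rows F-2772 `EdgeLikeCentralizerAt` / F-2773
`EdgeLikeCentralizer`, residual «infinite valence» of GAP row G-t6g3-2b; seat abc-iut-f-176 gen 3, desk memo
`HOME/staging/f/f-176/g3/FINDING-hadj-tame.md`; no definition, nothing specific to anabelioids).  Pure semi-graph
combinatorics in the currency of abc-iut-f-172's `TreeSystemGeodesicBaseEdges.lean` (`Walk.getVert`-indexed):

* `SemiGraph.exists_turn_getVert` — for a morphism `φ : T' ⟶ T`, a walk `p` of the subdivision of `T'` between two
  vertex-points and a vertex `u` of `T` other than the images of the ends and lying on EVERY walk between them: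
  some node `p_{i+1}` maps to the point of `u`, the node `p_i` before it maps into the SIDE of `u` containing the
  image of the start (reached from it avoiding `u`), the node `p_{i+2}` after it does not (least bad index);
* `SemiGraph.exists_getVert_add_five` / `exists_getVert_sub_three` — on a PATH between vertex-points, a
  vertex-point followed (preceded) by a branch-point `β` is followed (preceded) by the edge-point of `β`, the other
  branch `β' ≠ β` of that edge and the vertex-point `β'` abuts to;
* `SemiGraph.mem_support_of_mem_support_path` (every node of a path between vertex-points of a semi-graph with
  acyclic subdivision lies on every walk between them — abc-iut-f-172's `exists_mem_support_map_eq_of_mem_geodesic`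
  at the identity) and `SemiGraph.exists_separating_of_four_lt_dist` (two vertex-points at distance `> 4` of a
  tree-like semi-graph are separated by the vertex-point at position `4` of the geodesic).

Consumer: `TemperedSeparatingOverInfiniteValence.lean` (this seat).  Nothing here bears on [IUTchIII] Cor. 3.12;
no row of plan/FACT-LIST is asserted; typed ≠ proved elsewhere.
-/

namespace Literature.AnabelianGeometry.SemiGraphs

namespace SemiGraph

open CategoryTheory

universe u

variable {T : SemiGraph.{u}}

/-! ### Sides of a vertex in a semi-graph with acyclic subdivision -/

/-- A node reached from `a` avoiding `u` and a neighbour of it other than `u` is reached from `a` avoiding `u`.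
[cite: MochizukiSemiAnbd2006, §1 pp.11-13] -/
private theorem avoid_step {a u : T.Vertex} {z z' : T.Node}
    (hz : ∃ w : T.subdivision.Walk (Sum.inl a) z, (Sum.inl u : T.Node) ∉ w.support)
    (hadj : T.subdivision.Adj z z') (hne : z' ≠ Sum.inl u) :
    ∃ w : T.subdivision.Walk (Sum.inl a) z', (Sum.inl u : T.Node) ∉ w.support := by
  obtain ⟨w, hw⟩ := hz
  refine ⟨w.concat hadj, ?_⟩
  rw [SimpleGraph.Walk.support_concat]
  simp only [List.mem_append, List.mem_singleton, not_or]
  exact ⟨hw, fun h => hne h.symm⟩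

/-- **The turn.**  Let `φ : T' ⟶ T` with `T` of acyclic subdivision, `p` a walk of the subdivision of `T'` from the
point of `a` to the point of `a'`, and `u` a vertex of `T`, distinct from `φ a`, `φ a'`, lying on EVERY walk from
`φ a` to `φ a'`.  Then some node `p_{i+1}` of `p` maps to the point of `u`, the node `p_i` before it maps into the
side of `u` containing `φ a` (it is reached from `φ a` avoiding `u`) and the node `p_{i+2}` after it does not (and is
not the point of `u`): take the least index whose image is neither on that side nor the point of `u`.
[cite: MochizukiSemiAnbd2006, Thm 3.7(iii) p.41] -/
theorem exists_turn_getVert {T' : SemiGraph.{u}} (φ : T' ⟶ T)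
    {a a' : T'.Vertex} (p : T'.subdivision.Walk (Sum.inl a) (Sum.inl a')) (u : T.Vertex)
    (hu₀ : φ.vertexMap a ≠ u) (hu₁ : φ.vertexMap a' ≠ u)
    (hsep : ∀ w : T.subdivision.Walk (Sum.inl (φ.vertexMap a)) (Sum.inl (φ.vertexMap a')),
      (Sum.inl u : T.Node) ∈ w.support) :
    ∃ i : ℕ, i + 2 ≤ p.length ∧
      Sum.map φ.vertexMap (Sum.map φ.edgeMap φ.branchMap) (p.getVert (i + 1)) = Sum.inl u ∧
      (∃ w : T.subdivision.Walk (Sum.inl (φ.vertexMap a))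
          (Sum.map φ.vertexMap (Sum.map φ.edgeMap φ.branchMap) (p.getVert i)),
        (Sum.inl u : T.Node) ∉ w.support) ∧
      (¬ ∃ w : T.subdivision.Walk (Sum.inl (φ.vertexMap a))
          (Sum.map φ.vertexMap (Sum.map φ.edgeMap φ.branchMap) (p.getVert (i + 2))),
        (Sum.inl u : T.Node) ∉ w.support) ∧
      Sum.map φ.vertexMap (Sum.map φ.edgeMap φ.branchMap) (p.getVert (i + 2)) ≠ Sum.inl u := by
  classical
  -- the side of `u` containing `φ a`, together with the point of `u`: the "good" images
  let P : ℕ → Prop := fun n =>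
    (∃ w : T.subdivision.Walk (Sum.inl (φ.vertexMap a))
        (Sum.map φ.vertexMap (Sum.map φ.edgeMap φ.branchMap) (p.getVert n)),
      (Sum.inl u : T.Node) ∉ w.support) ∨
      Sum.map φ.vertexMap (Sum.map φ.edgeMap φ.branchMap) (p.getVert n) = Sum.inl u
  have hΦ0 : Sum.map φ.vertexMap (Sum.map φ.edgeMap φ.branchMap) (p.getVert 0) =
      Sum.inl (φ.vertexMap a) := by
    rw [SimpleGraph.Walk.getVert_zero]; rfl
  have hP0 : P 0 := by
    left
    rw [hΦ0]
    refine ⟨SimpleGraph.Walk.nil, ?_⟩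
    simp only [SimpleGraph.Walk.support_nil, List.mem_singleton, Sum.inl.injEq]
    exact fun h => hu₀ h.symm
  have hPlen : ¬ P p.length := by
    have hΦl : Sum.map φ.vertexMap (Sum.map φ.edgeMap φ.branchMap) (p.getVert p.length) =
        Sum.inl (φ.vertexMap a') := by
      rw [SimpleGraph.Walk.getVert_length]; rfl
    rintro (⟨w, hw⟩ | h)
    · have hmem := hsep (w.copy rfl hΦl)
      rw [SimpleGraph.Walk.support_copy] at hmem
      exact hw hmem
    · rw [hΦl] at h
      exact hu₁ (Sum.inl_injective h)
  have hex : ∃ n, ¬ P n := ⟨p.length, hPlen⟩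
  obtain ⟨t, htP, htmin, htlen⟩ : ∃ t, ¬ P t ∧ (∀ m, m < t → P m) ∧ t ≤ p.length :=
    ⟨Nat.find hex, Nat.find_spec hex, fun m hm => not_not.mp (Nat.find_min hex hm),
      Nat.find_min' hex hPlen⟩
  have ht0 : t ≠ 0 := fun h => htP (h ▸ hP0)
  obtain ⟨s, rfl⟩ := Nat.exists_eq_succ_of_ne_zero ht0
  -- the image adjacency `p_s ~ p_{s+1}`
  have hadj₁ : T.subdivision.Adj (Sum.map φ.vertexMap (Sum.map φ.edgeMap φ.branchMap) (p.getVert s))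
      (Sum.map φ.vertexMap (Sum.map φ.edgeMap φ.branchMap) (p.getVert (s + 1))) :=
    T'.subdivision_adj_map φ (p.adj_getVert_succ (by omega))
  -- `p_{s+1}` is bad, so `p_s` must be the point of `u`
  have hs : Sum.map φ.vertexMap (Sum.map φ.edgeMap φ.branchMap) (p.getVert s) = Sum.inl u := by
    rcases htmin s (Nat.lt_succ_self s) with hgood | hgood
    · exfalso
      refine htP (Or.inl (avoid_step hgood hadj₁ fun h => htP (Or.inr h)))
    · exact hgood
  have hs0 : s ≠ 0 := by
    rintro rfl
    rw [hΦ0] at hs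
    exact hu₀ (Sum.inl_injective hs)
  obtain ⟨i, rfl⟩ := Nat.exists_eq_succ_of_ne_zero hs0
  -- `p_i` is good and adjacent to the point of `u`, hence on the side of `φ a`
  have hadj₀ : T.subdivision.Adj (Sum.map φ.vertexMap (Sum.map φ.edgeMap φ.branchMap) (p.getVert i))
      (Sum.map φ.vertexMap (Sum.map φ.edgeMap φ.branchMap) (p.getVert (i + 1))) :=
    T'.subdivision_adj_map φ (p.adj_getVert_succ (by omega))
  rw [hs] at hadj₀
  have hi : ∃ w : T.subdivision.Walk (Sum.inl (φ.vertexMap a))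
      (Sum.map φ.vertexMap (Sum.map φ.edgeMap φ.branchMap) (p.getVert i)),
      (Sum.inl u : T.Node) ∉ w.support := by
    rcases htmin i (by omega) with hgood | hgood
    · exact hgood
    · exact absurd hgood hadj₀.ne
  refine ⟨i, htlen, hs, hi, fun h => htP (Or.inl h), fun h => htP (Or.inr h)⟩

/-- A node mapping to a vertex-point is a vertex-point. [cite: MochizukiSemiAnbd2006, §1 p.11] -/
private theorem exists_eq_inl_of_map_eq_inl {T' : SemiGraph.{u}} (φ : T' ⟶ T) {z : T'.Node} {u : T.Vertex}
    (h : Sum.map φ.vertexMap (Sum.map φ.edgeMap φ.branchMap) z = Sum.inl u) :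
    ∃ v : T'.Vertex, z = Sum.inl v ∧ φ.vertexMap v = u := by
  rcases z with v | e | b
  · exact ⟨v, rfl, by simpa using h⟩
  · simp at h
  · simp at h

/-! ### Local structure of paths of the subdivision -/

/-- **After a branch-point.**  On a PATH of the subdivision between two vertex-points, a vertex-point `p_{i+1}`
followed by a branch-point `p_{i+2}` (a branch `β` at that vertex) is followed by the edge-point of `β`, the other
branch `β' ≠ β` of that edge and the vertex-point `p_{i+5}` to which `β'` abuts.
[cite: MochizukiSemiAnbd2006, §1 pp.11-12] -/
theorem exists_getVert_add_five {a a' v : T.Vertex} {p : T.subdivision.Walk (Sum.inl a) (Sum.inl a')}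
    (hp : p.IsPath) {i : ℕ} {β : T.Branch} (hi : i + 2 ≤ p.length)
    (h1 : p.getVert (i + 1) = Sum.inl v) (h2 : p.getVert (i + 2) = Sum.inr (Sum.inr β)) :
    ∃ (β' : T.Branch) (v' : T.Vertex), β' ≠ β ∧ T.edgeOf β' = T.edgeOf β ∧ T.abuts β' = some v' ∧
      i + 5 ≤ p.length ∧ p.getVert (i + 5) = Sum.inl v' := by
  have hinj := hp.getVert_injOn
  -- `β` abuts to `v`
  have h12 : T.subdivision.Adj (Sum.inl v) (Sum.inr (Sum.inr β)) := by
    rw [← h1, ← h2]; exact p.adj_getVert_succ (by omega)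
  obtain ⟨b, hbv, hb⟩ := (T.subdivision_adj_inl_iff v _).1 h12
  have hbβ : b = β := by simpa using hb.symm
  subst hbβ
  -- position `i + 3`: the edge-point of `β`
  have hi2 : i + 2 < p.length := by
    by_contra hle
    have hle' : p.length ≤ i + 2 := by omega
    have := p.getVert_of_length_le hle'
    rw [h2] at this
    simp at this
  have h23 : T.subdivision.Adj (Sum.inr (Sum.inr b)) (p.getVert (i + 3)) := by
    rw [← h2]; exact p.adj_getVert_succ (by omega)
  rcases (T.subdivision_adj_branch_iff b _).1 h23 with h3 | ⟨v'', hv'', h3⟩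
  swap
  · exfalso
    rw [hbv] at hv''
    have hvv : v'' = v := by simpa using hv''.symm
    subst hvv
    have heq : p.getVert (i + 3) = p.getVert (i + 1) := by rw [h3, h1]
    have := hinj (by rw [Set.mem_setOf_eq]; omega) (by rw [Set.mem_setOf_eq]; omega) heq
    omega
  -- position `i + 4`: a branch `β'` of the same edge, `β' ≠ β`
  have hi3 : i + 3 < p.length := by
    by_contra hle
    have hle' : p.length ≤ i + 3 := by omega
    have := p.getVert_of_length_le hle'
    rw [h3] at this
    simp at this
  have h34 : T.subdivision.Adj (Sum.inr (Sum.inl (T.edgeOf b))) (p.getVert (i + 4)) := by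
    rw [← h3]; exact p.adj_getVert_succ (by omega)
  obtain ⟨β', hβ'e, h4⟩ := (T.subdivision_adj_edge_iff _ _).1 h34
  have hβ'ne : β' ≠ b := by
    rintro rfl
    have heq : p.getVert (i + 4) = p.getVert (i + 2) := by rw [h4, h2]
    have := hinj (by rw [Set.mem_setOf_eq]; omega) (by rw [Set.mem_setOf_eq]; omega) heq
    omega
  -- position `i + 5`: the vertex `β'` abuts to
  have hi4 : i + 4 < p.length := by
    by_contra hle
    have hle' : p.length ≤ i + 4 := by omega
    have := p.getVert_of_length_le hle'
    rw [h4] at this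
    simp at this
  have h45 : T.subdivision.Adj (Sum.inr (Sum.inr β')) (p.getVert (i + 5)) := by
    rw [← h4]; exact p.adj_getVert_succ (by omega)
  rcases (T.subdivision_adj_branch_iff β' _).1 h45 with h5 | ⟨v', hv', h5⟩
  · exfalso
    rw [hβ'e] at h5
    have heq : p.getVert (i + 5) = p.getVert (i + 3) := by rw [h5, h3]
    have := hinj (by rw [Set.mem_setOf_eq]; omega) (by rw [Set.mem_setOf_eq]; omega) heq
    omega
  · exact ⟨β', v', hβ'ne, hβ'e, hv', by omega, h5⟩

/-- **Before a branch-point.**  On a PATH of the subdivision between two vertex-points, a branch-point `p_i` (a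
branch `β`) followed by a vertex-point `p_{i+1}` is preceded by the edge-point of `β`, the other branch `β' ≠ β` of
that edge and the vertex-point `p_{i-3}` to which `β'` abuts.
[cite: MochizukiSemiAnbd2006, §1 pp.11-12] -/
theorem exists_getVert_sub_three {a a' v : T.Vertex} {p : T.subdivision.Walk (Sum.inl a) (Sum.inl a')}
    (hp : p.IsPath) {i : ℕ} {β : T.Branch} (hi : i + 1 ≤ p.length)
    (h1 : p.getVert (i + 1) = Sum.inl v) (h0 : p.getVert i = Sum.inr (Sum.inr β)) :
    ∃ (β' : T.Branch) (v' : T.Vertex), β' ≠ β ∧ T.edgeOf β' = T.edgeOf β ∧ T.abuts β' = some v' ∧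
      3 ≤ i ∧ p.getVert (i - 3) = Sum.inl v' := by
  have hinj := hp.getVert_injOn
  -- `β` abuts to `v`
  have h01 : T.subdivision.Adj (Sum.inl v) (Sum.inr (Sum.inr β)) := by
    rw [← h1, ← h0]; exact (p.adj_getVert_succ (by omega)).symm
  obtain ⟨b, hbv, hb⟩ := (T.subdivision_adj_inl_iff v _).1 h01
  have hbβ : b = β := by simpa using hb.symm
  subst hbβ
  -- position `i - 1`: the edge-point of `β`
  have hi0 : i ≠ 0 := by
    rintro rfl
    rw [SimpleGraph.Walk.getVert_zero] at h0
    simp at h0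
  obtain ⟨i₁, rfl⟩ := Nat.exists_eq_succ_of_ne_zero hi0
  have h10 : T.subdivision.Adj (Sum.inr (Sum.inr b)) (p.getVert i₁) := by
    rw [← h0]; exact (p.adj_getVert_succ (by omega)).symm
  rcases (T.subdivision_adj_branch_iff b _).1 h10 with h3 | ⟨v'', hv'', h3⟩
  swap
  · exfalso
    rw [hbv] at hv''
    have hvv : v'' = v := by simpa using hv''.symm
    subst hvv
    have heq : p.getVert i₁ = p.getVert (i₁ + 1 + 1) := by rw [h3, h1]
    have := hinj (by rw [Set.mem_setOf_eq]; omega) (by rw [Set.mem_setOf_eq]; omega) heq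
    omega
  -- position `i - 2`: a branch `β'` of the same edge, `β' ≠ β`
  have hi1 : i₁ ≠ 0 := by
    rintro rfl
    rw [SimpleGraph.Walk.getVert_zero] at h3
    simp at h3
  obtain ⟨i₂, rfl⟩ := Nat.exists_eq_succ_of_ne_zero hi1
  have h21 : T.subdivision.Adj (Sum.inr (Sum.inl (T.edgeOf b))) (p.getVert i₂) := by
    rw [← h3]; exact (p.adj_getVert_succ (by omega)).symm
  obtain ⟨β', hβ'e, h4⟩ := (T.subdivision_adj_edge_iff _ _).1 h21
  have hβ'ne : β' ≠ b := by
    rintro rfl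
    have heq : p.getVert i₂ = p.getVert (i₂ + 1 + 1) := by rw [h4, h0]
    have := hinj (by rw [Set.mem_setOf_eq]; omega) (by rw [Set.mem_setOf_eq]; omega) heq
    omega
  -- position `i - 3`: the vertex `β'` abuts to
  have hi2 : i₂ ≠ 0 := by
    rintro rfl
    rw [SimpleGraph.Walk.getVert_zero] at h4
    simp at h4
  obtain ⟨i₃, rfl⟩ := Nat.exists_eq_succ_of_ne_zero hi2
  have h32 : T.subdivision.Adj (Sum.inr (Sum.inr β')) (p.getVert i₃) := by
    rw [← h4]; exact (p.adj_getVert_succ (by omega)).symm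
  rcases (T.subdivision_adj_branch_iff β' _).1 h32 with h5 | ⟨v', hv', h5⟩
  · exfalso
    rw [hβ'e] at h5
    have heq : p.getVert i₃ = p.getVert (i₃ + 1 + 1) := by rw [h5, h3]
    have := hinj (by rw [Set.mem_setOf_eq]; omega) (by rw [Set.mem_setOf_eq]; omega) heq
    omega
  · refine ⟨β', v', hβ'ne, hβ'e, hv', by omega, ?_⟩
    have : i₃ + 1 + 1 + 1 - 3 = i₃ := by omega
    rw [this, h5]

/-- **A node of the geodesic lies on every walk** (tree-likeness): in a semi-graph with acyclic subdivision, every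
node of a path between two vertex-points lies on every walk between them (abc-iut-f-172's
`exists_mem_support_map_eq_of_mem_geodesic` for the identity morphism). [cite: MochizukiSemiAnbd2006, §1 p.13] -/
theorem mem_support_of_mem_support_path (hT : T.subdivision.IsAcyclic) {a a' : T.Vertex}
    (q : T.subdivision.Walk (Sum.inl a) (Sum.inl a')) (hq : q.IsPath) {z : T.Node} (hz : z ∈ q.support)
    (w : T.subdivision.Walk (Sum.inl a) (Sum.inl a')) : z ∈ w.support := by
  obtain ⟨z', hz', hzz'⟩ := exists_mem_support_map_eq_of_mem_geodesic hT (𝟙 T) w q hq hz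
  simp only [id_vertexMap, id_edgeMap, id_branchMap, Sum.map_id_id, id_eq] at hzz'
  rw [← hzz']
  exact hz'

/-- **A far pair has a separating vertex.**  In a semi-graph whose subdivision is a tree, if the points of two
vertices are at distance `> 4` then some third vertex lies on every walk between them (the vertex-point at
position `4` of the geodesic: along a path from a vertex-point the nodes run vertex, branch, edge, branch, vertex).
[cite: MochizukiSemiAnbd2006, §1 p.13] -/
theorem exists_separating_of_four_lt_dist (hT : T.subdivision.IsTree) {a a' : T.Vertex}
    (h : ¬ T.subdivision.dist (Sum.inl a) (Sum.inl a') ≤ 4) :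
    ∃ u : T.Vertex, u ≠ a ∧ u ≠ a' ∧
      ∀ w : T.subdivision.Walk (Sum.inl a) (Sum.inl a'), (Sum.inl u : T.Node) ∈ w.support := by
  obtain ⟨q, hq⟩ := hT.connected.exists_walk_length_eq_dist (Sum.inl a) (Sum.inl a')
  have hqp : q.IsPath := q.isPath_of_length_eq_dist hq
  have hinj := hqp.getVert_injOn
  have hlen : 4 < q.length := by omega
  -- position 1: a branch at `a`
  have h01 : T.subdivision.Adj (Sum.inl a) (q.getVert 1) := by
    have := q.adj_getVert_succ (i := 0) (by omega)
    rwa [SimpleGraph.Walk.getVert_zero] at this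
  obtain ⟨β₁, hβ₁a, h1⟩ := (T.subdivision_adj_inl_iff a _).1 h01
  -- position 2: the edge-point
  have h12 : T.subdivision.Adj (Sum.inr (Sum.inr β₁)) (q.getVert 2) := by
    rw [← h1]; exact q.adj_getVert_succ (by omega)
  rcases (T.subdivision_adj_branch_iff β₁ _).1 h12 with h2 | ⟨v'', hv'', h2⟩
  swap
  · exfalso
    rw [hβ₁a] at hv''
    have hvv : v'' = a := by simpa using hv''.symm
    subst hvv
    have heq : q.getVert 2 = q.getVert 0 := by rw [h2, SimpleGraph.Walk.getVert_zero]
    have := hinj (by rw [Set.mem_setOf_eq]; omega) (by rw [Set.mem_setOf_eq]; omega) heq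
    omega
  -- position 3: a branch of the same edge
  have h23 : T.subdivision.Adj (Sum.inr (Sum.inl (T.edgeOf β₁))) (q.getVert 3) := by
    rw [← h2]; exact q.adj_getVert_succ (by omega)
  obtain ⟨β₂, hβ₂e, h3⟩ := (T.subdivision_adj_edge_iff _ _).1 h23
  -- position 4: a vertex-point
  have h34 : T.subdivision.Adj (Sum.inr (Sum.inr β₂)) (q.getVert 4) := by
    rw [← h3]; exact q.adj_getVert_succ (by omega)
  rcases (T.subdivision_adj_branch_iff β₂ _).1 h34 with h4 | ⟨u, hu, h4⟩
  · exfalso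
    rw [hβ₂e] at h4
    have heq : q.getVert 4 = q.getVert 2 := by rw [h4, h2]
    have := hinj (by rw [Set.mem_setOf_eq]; omega) (by rw [Set.mem_setOf_eq]; omega) heq
    omega
  refine ⟨u, ?_, ?_, fun w => ?_⟩
  · rintro rfl
    have heq : q.getVert 4 = q.getVert 0 := by rw [h4, SimpleGraph.Walk.getVert_zero]
    have := hinj (by rw [Set.mem_setOf_eq]; omega) (by rw [Set.mem_setOf_eq]; omega) heq
    omega
  · rintro rfl
    have heq : q.getVert 4 = q.getVert q.length := by rw [h4, SimpleGraph.Walk.getVert_length]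
    have := hinj (by rw [Set.mem_setOf_eq]; omega) (by rw [Set.mem_setOf_eq]) heq
    omega
  · exact mem_support_of_mem_support_path hT.isAcyclic q hqp (h4 ▸ q.getVert_mem_support 4) w

end SemiGraph

end Literature.AnabelianGeometry.SemiGraphs
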